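import Literature.IUT.LogThetaLattice.HodgeTheaterLogLinkProp13iii

/-!
# Kernel DAG index — RE-KEY part a (hand-written by abc-iut-c312-2 gen 4 @2026-08-26T06:55Z): corrected nodes for two mis-resolved rows

index v1 · spec HOME/plan/KERNEL-DAG-SPEC.md v1.3 §5 ("re-file when nodes change status") applied to RESOLUTION ERRORS, append-only:
a landed index decl is never edited; a mis-resolved node gets a CORRECTED SIBLING under the primed kernel id `N_<id>'` and abc-iut-dag
is asked to RE-KEY the DAG row (`kernel_id := N_<id>'`); the old decl stays as a harmless alias (a NAME, asserting nothing).

THIS FILE PROVES NOTHING NEW AND ASSERTS NOTHING. Finding of abc-iut-w6-d007 (06:46:57Z, kernel-checked probe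
HOME/staging/w6/w6-d007/indexscan/IndexRekeyProp13iii.lean 04938a7f965036f9): the generator (gen 3) resolved the DAG.tsv token
«Prop13iii» of the rows `IUTchIII:Prop1.3(iii)` and `IUTchIII:Prop1.3/iii.r6` by SHORT NAME across layers, yielding the data aliases
`N_IUTchIII_Prop1_3_iii := @N_AbsTopII_Prop1_3_iii` (DAGL6t l.293) and `N_IUTchIII_Prop1_3_iii_r6 := @…AbsoluteAnabelian.DPSCData.Prop13iii`
(DAGL6y l.213) — both point at [AbsTopII]/[AbsTopIII]-side declarations, not at [IUTchIII] Prop 1.3 (iii). (Kernel-harmless: data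
aliases assert nothing; but misleading for the layer certificates.) Since p428027 (abc-iut-c312-3 / w6-d007 lineage,
`Literature/IUT/LogThetaLattice/HodgeTheaterLogLinkProp13iii.lean`, ACCEPTED 06:14Z) the row HAS its landed theorems: this part names
them. The generator is fixed from cycle c07 on (short-name matches outside the row's candidate modules are accepted only inside the
row-layer's own module prefixes). `IUTchIII:Prop1.3/iv.r7` (DAGL6y l.219, alias of an [IUTchI] kit type) is likewise mis-resolved; its
DAG.tsv tokens (`LTL.FrobeniusChain`, …) name no tree declaration yet, so no corrected sibling can be given — reported to dag.
Nothing here says abc is proved or refuted or takes a side on [IUTchIII] Cor 3.12. typed ≠ discharged; indexed ≠ endorsed.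
-/

namespace Summit.ABC.IUTFork.DAG

namespace PartRa
/-- `StatementOf h` is the statement (a `Prop`) of which the landed `h` is the proof: the index NAMES statements, it never re-types them. -/
abbrev StatementOf {P : Prop} (_h : P) : Prop := P
end PartRa
open PartRa

noncomputable section
universe u₁

/-- [node IUTchIII:Prop1.3(iii) · L6/D3 · [IUTchIII] Prop 1.3 (iii), kurims p.41–42 · p428027 · claim · DAG status landed(p406456)→(decls
p428027) · CORRECTED SIBLING of the mis-resolved alias `N_IUTchIII_Prop1_3_iii` (DAGL6t l.293); dag: RE-KEY kernel_id :=
`N_IUTchIII_Prop1_3_iii'`] decls 6 (w6-d007's kernel-checked list): the log-link's induced full poly-isomorphism of F⊢×μ-prime-strips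
through the coric holomorphic log-shells — `prop13iii`, `stripLink_coricHolShell_eq`, `mem_stripLink_coricHolShell_iff`,
`stripLink_coricHolShell_nonempty`, `stripLink_coricHolShell_full`, `prop13iii_all`. -/
def N_IUTchIII_Prop1_3_iii' : Prop :=
  StatementOf @Literature.IUT.LogThetaLattice.HTLogLink.prop13iii.{u₁} ∧
  StatementOf @Literature.IUT.LogThetaLattice.HTLogLink.stripLink_coricHolShell_eq.{u₁} ∧
  StatementOf @Literature.IUT.LogThetaLattice.HTLogLink.mem_stripLink_coricHolShell_iff.{u₁} ∧
  StatementOf @Literature.IUT.LogThetaLattice.HTLogLink.stripLink_coricHolShell_nonempty.{u₁} ∧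
  StatementOf @Literature.IUT.LogThetaLattice.HTLogLink.stripLink_coricHolShell_full.{u₁} ∧
  StatementOf @Literature.IUT.LogThetaLattice.HTLogLink.prop13iii_all.{u₁}
/-- witness of `N_IUTchIII_Prop1_3_iii'`: the six landed theorems of p428027, BY NAME (spec §2(c)); `_holds` because every printed clause
of (iii) is among them per w6-d007's per-clause coverage line 06:1xZ (L6-lead NODES token pending — if the lead keeps the row `landed`,
read this as `_part`); proves nothing new. -/
theorem N_IUTchIII_Prop1_3_iii'_holds : N_IUTchIII_Prop1_3_iii' :=
  ⟨@Literature.IUT.LogThetaLattice.HTLogLink.prop13iii, @Literature.IUT.LogThetaLattice.HTLogLink.stripLink_coricHolShell_eq,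
    @Literature.IUT.LogThetaLattice.HTLogLink.mem_stripLink_coricHolShell_iff,
    @Literature.IUT.LogThetaLattice.HTLogLink.stripLink_coricHolShell_nonempty,
    @Literature.IUT.LogThetaLattice.HTLogLink.stripLink_coricHolShell_full, @Literature.IUT.LogThetaLattice.HTLogLink.prop13iii_all⟩

/-- [node IUTchIII:Prop1.3/iii.r6 · L6 sub-DAG row · (iii) p.42 l.44–48 · p428027 · claim · DAG status discharged(p404642) · CORRECTED
SIBLING of the mis-resolved alias `N_IUTchIII_Prop1_3_iii_r6` (DAGL6y l.213); dag: RE-KEY kernel_id := `N_IUTchIII_Prop1_3_iii_r6'`]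
three of the six theorems of p428027 (the all-labels form `prop13iii_all`, the per-label form `prop13iii`, fullness
`stripLink_coricHolShell_full`) — the names the sub-row's sentence (p.42 l.44–48) needs; the full six are `N_IUTchIII_Prop1_3_iii'`. -/
def N_IUTchIII_Prop1_3_iii_r6' : Prop :=
  StatementOf @Literature.IUT.LogThetaLattice.HTLogLink.prop13iii_all.{u₁} ∧
  StatementOf @Literature.IUT.LogThetaLattice.HTLogLink.prop13iii.{u₁} ∧
  StatementOf @Literature.IUT.LogThetaLattice.HTLogLink.stripLink_coricHolShell_full.{u₁}
/-- discharge of `N_IUTchIII_Prop1_3_iii_r6'` (row discharged in DAG.tsv): BY NAME; proves nothing new. -/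
theorem N_IUTchIII_Prop1_3_iii_r6'_holds : N_IUTchIII_Prop1_3_iii_r6' :=
  ⟨@Literature.IUT.LogThetaLattice.HTLogLink.prop13iii_all, @Literature.IUT.LogThetaLattice.HTLogLink.prop13iii,
    @Literature.IUT.LogThetaLattice.HTLogLink.stripLink_coricHolShell_full⟩

end

end Summit.ABC.IUTFork.DAG
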